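import Summits.QuantumFields.YangMills.Theses.BalabanLadder
import Summits.QuantumFields.YangMills.Theorems.BalabanLadderUVSeamRecStubTransport
import HarnessLib

/-!
# Crux `UVSeamRec` (stmt-QuantumFields-20043), stub `stub_floors`: exact dilation covariance of the unit

Helper file (`--supports stmt-QuantumFields-20043`) of the lead prover of `stub_floors` (unit `ym-spine-20043-p1`).

The two legs of the seam crux `UVSeamRec` — the non-triviality floors `LowerBounds G r u` and the plane-resolved
centred-moment ceilings `MomentBounds6 G r u` — depend on the unit map `u` ONLY through the smearing scale of the
test functions (`Q2 β L (u β)`, `Q3 β L (u β)`), the volume threshold `Λ₅ ≤ u β · L` and the collar constraint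
`R · u β ≤ ℓ₄`.  All three are EXACTLY covariant under `u ↦ c · u` for a constant `c > 0`: dilate the test
functions by `c` (a Schwartz automorphism preserving positive-time support and disjointness of supports), divide
`Λ₅` and `ℓ₄` by `c`.  Hence (this file, all sorry-free):

* `lowerBounds_const_mul_iff` : `LowerBounds G r (c · a) ↔ LowerBounds G r a`;
* `momentBounds6_const_mul_iff`, `momentBounds_const_mul_iff`, `gapInUnits_const_mul_iff` : the same for the
  ceilings and for the gap-in-units leg;
* `uvSeamRec_iff_const_mul` : the route decl `…Theses.BalabanLadder.UVSeamRec` is EQUIVALENT to the same statement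
  at the rescaled unit of record `c · uRec` for every `c > 0`; likewise the two open stubs of the registered skeleton
  (`stubFloors_iff_const_mul`, `stubCeilings_iff_const_mul`).

Consequence for the line (numbers, not adjectives): the unit of record is only determined up to a positive constant
— the kill-criterion repair «restate `u ↦ u/M`» of the route text is VOID (it restates nothing), and any engine that
delivers floors/ceilings at a unit `a_F` with `a_F = c · uRec` EXACTLY closes the stubs; what the pinned unit really
costs is the asymptotic statement `a_F(β)/uRec(β) → c₀ ∈ (0, ∞)` (two-loop asymptotic scaling of the engine's unit),
handled by the companion transfer lemma (separate file).
-/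

set_option autoImplicit false

noncomputable section

open scoped SchwartzMap
open MeasureTheory Filter Topology
open Literature.MathematicalPhysics.QuantumFieldTheory Literature.MathematicalPhysics.QuantumLattice
open Summit.QuantumFields.YangMills.Cruxes.OSLegsFromFemtoAndGap.DlrCollarTransfer

namespace Summit.QuantumFields.YangMills.Cruxes.UVSeamRec.UnitDilation

variable {G : Type} [Group G] [TopologicalSpace G] [IsTopologicalGroup G] [CompactSpace G]
  [MeasurableSpace G] [BorelSpace G]

/-! ### Dilation of test functions along a scalar continuous linear automorphism `D = c • id` -/

section Dilation

variable (D : (EuclideanSpace ℝ (Fin 4)) ≃L[ℝ] (EuclideanSpace ℝ (Fin 4))) (c : ℝ) (hD : ∀ x : (EuclideanSpace ℝ (Fin 4)), D x = c • x)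
include hD

/-- A test function composed with `D = c • id`, read at the smeared lattice point `s • X`, is the original test
function read at scale `c * s`. [folklore] -/
theorem compCLM_apply_smul (f : 𝓢((EuclideanSpace ℝ (Fin 4)), ℝ)) (s : ℝ) (X : (EuclideanSpace ℝ (Fin 4))) :
    SchwartzMap.compCLMOfContinuousLinearEquiv ℝ D f (s • X) = f ((c * s) • X) := by
  rw [SchwartzMap.compCLMOfContinuousLinearEquiv_apply, Function.comp_apply, hD, smul_smul]

/-- Time reflection commutes with the dilation, read pointwise. [folklore] -/
theorem thetaTest_compCLM_apply (f : 𝓢((EuclideanSpace ℝ (Fin 4)), ℝ)) (s : ℝ) (X : (EuclideanSpace ℝ (Fin 4))) :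
    thetaTest 4 (SchwartzMap.compCLMOfContinuousLinearEquiv ℝ D f) (s • X) =
      thetaTest 4 f ((c * s) • X) := by
  rw [thetaTest_apply, thetaTest_apply, SchwartzMap.compCLMOfContinuousLinearEquiv_apply, Function.comp_apply, hD,
    (timeReflection 4).map_smul, (timeReflection 4).map_smul, smul_smul]

/-- **Dilation covariance of `Q2`**: smearing the dilated test functions at scale `s` is smearing the original
ones at scale `c * s`. [folklore] -/
theorem Q2_compCLM (r : LatticeRep G) (β : ℝ) (L : ℕ) (s : ℝ) (f g : 𝓢((EuclideanSpace ℝ (Fin 4)), ℝ)) :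
    Q2 G r β L s (SchwartzMap.compCLMOfContinuousLinearEquiv ℝ D f)
        (SchwartzMap.compCLMOfContinuousLinearEquiv ℝ D g) = Q2 G r β L (c * s) f g := by
  unfold Q2
  simp only [compCLM_apply_smul D c hD]

/-- **Dilation covariance of `Q2` in the reflection-paired form** used by `LowerBounds`. [folklore] -/
theorem Q2_theta_compCLM (r : LatticeRep G) (β : ℝ) (L : ℕ) (s : ℝ) (v : 𝓢((EuclideanSpace ℝ (Fin 4)), ℝ)) :
    Q2 G r β L s (thetaTest 4 (SchwartzMap.compCLMOfContinuousLinearEquiv ℝ D v))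
        (SchwartzMap.compCLMOfContinuousLinearEquiv ℝ D v) = Q2 G r β L (c * s) (thetaTest 4 v) v := by
  unfold Q2
  simp only [compCLM_apply_smul D c hD, thetaTest_compCLM_apply D c hD]

/-- **Dilation covariance of `Q3`.** [folklore] -/
theorem Q3_compCLM (r : LatticeRep G) (β : ℝ) (L : ℕ) (s : ℝ) (f g h : 𝓢((EuclideanSpace ℝ (Fin 4)), ℝ)) :
    Q3 G r β L s (SchwartzMap.compCLMOfContinuousLinearEquiv ℝ D f)
        (SchwartzMap.compCLMOfContinuousLinearEquiv ℝ D g) (SchwartzMap.compCLMOfContinuousLinearEquiv ℝ D h) =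
      Q3 G r β L (c * s) f g h := by
  unfold Q3
  simp only [compCLM_apply_smul D c hD]

omit hD in
/-- The support of a dilated test function is the preimage of the support. [folklore] -/
theorem tsupport_compCLM (f : 𝓢((EuclideanSpace ℝ (Fin 4)), ℝ)) :
    tsupport (SchwartzMap.compCLMOfContinuousLinearEquiv ℝ D f : (EuclideanSpace ℝ (Fin 4)) → ℝ) = D ⁻¹' tsupport (f : (EuclideanSpace ℝ (Fin 4)) → ℝ) := by
  rw [SchwartzMap.compCLMOfContinuousLinearEquiv_apply]
  exact tsupport_comp_eq_preimage (f : (EuclideanSpace ℝ (Fin 4)) → ℝ) D.toHomeomorph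

omit hD in
/-- Dilation preserves disjointness of supports. [folklore] -/
theorem disjoint_tsupport_compCLM {f g : 𝓢((EuclideanSpace ℝ (Fin 4)), ℝ)}
    (h : Disjoint (tsupport (f : (EuclideanSpace ℝ (Fin 4)) → ℝ)) (tsupport (g : (EuclideanSpace ℝ (Fin 4)) → ℝ))) :
    Disjoint (tsupport (SchwartzMap.compCLMOfContinuousLinearEquiv ℝ D f : (EuclideanSpace ℝ (Fin 4)) → ℝ))
      (tsupport (SchwartzMap.compCLMOfContinuousLinearEquiv ℝ D g : (EuclideanSpace ℝ (Fin 4)) → ℝ)) := by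
  rw [tsupport_compCLM D f, tsupport_compCLM D g]
  exact h.preimage _

/-- A positive dilation preserves positive-time support. [folklore] -/
theorem tsupport_compCLM_subset_pos (hc : 0 < c) {f : 𝓢((EuclideanSpace ℝ (Fin 4)), ℝ)} (hf : tsupport (f : (EuclideanSpace ℝ (Fin 4)) → ℝ) ⊆ {y : (EuclideanSpace ℝ (Fin 4)) | 0 < y 0}) :
    tsupport (SchwartzMap.compCLMOfContinuousLinearEquiv ℝ D f : (EuclideanSpace ℝ (Fin 4)) → ℝ) ⊆ {y : (EuclideanSpace ℝ (Fin 4)) | 0 < y 0} := by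
  rw [tsupport_compCLM D f]
  intro y hy
  have hy' : D y ∈ tsupport (f : (EuclideanSpace ℝ (Fin 4)) → ℝ) := hy
  have h0 : 0 < (D y) 0 := hf hy'
  rw [hD] at h0
  simp only [PiLp.smul_apply, smul_eq_mul] at h0
  exact pos_of_mul_pos_right h0 hc.le

end Dilation

/-- The dilation `x ↦ c • x`, `c ≠ 0`, is a continuous linear automorphism of `E⁴`. [folklore] -/
theorem exists_dilation (c : ℝ) (hc : c ≠ 0) : ∃ D : (EuclideanSpace ℝ (Fin 4)) ≃L[ℝ] (EuclideanSpace ℝ (Fin 4)), ∀ x : (EuclideanSpace ℝ (Fin 4)), D x = c • x :=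
  ⟨ContinuousLinearEquiv.smulLeft (Units.mk0 c hc), fun _ => rfl⟩

/-! ### The floors -/

/-- **Floors at unit `c · a` give floors at unit `a`** (`c > 0`): dilate the witnesses by `c`, divide the volume
threshold by `c`. [folklore] -/
theorem lowerBounds_of_const_mul (r : LatticeRep G) {a : ℝ → ℝ} {c : ℝ} (hc : 0 < c)
    (h : LowerBounds G r (fun β => c * a β)) : LowerBounds G r a := by
  obtain ⟨D, hD⟩ := exists_dilation c hc.ne'
  obtain ⟨⟨v, ε, β₅, Λ₅, hv, hε, h2⟩, ⟨f, g, k, ε', β₅', Λ₅', hfg, hgk, hfk, hε', h3⟩⟩ := h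
  refine ⟨⟨SchwartzMap.compCLMOfContinuousLinearEquiv ℝ D v, ε, β₅, Λ₅ / c,
      tsupport_compCLM_subset_pos D c hD hc hv, hε, fun β hβ L hL => ?_⟩,
    ⟨SchwartzMap.compCLMOfContinuousLinearEquiv ℝ D f, SchwartzMap.compCLMOfContinuousLinearEquiv ℝ D g,
      SchwartzMap.compCLMOfContinuousLinearEquiv ℝ D k, ε', β₅', Λ₅' / c,
      disjoint_tsupport_compCLM D hfg, disjoint_tsupport_compCLM D hgk, disjoint_tsupport_compCLM D hfk, hε',
      fun β hβ L hL => ?_⟩⟩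
  · rw [Q2_theta_compCLM D c hD]
    exact h2 β hβ L (by rw [div_le_iff₀ hc] at hL; linarith [hL])
  · rw [Q3_compCLM D c hD]
    exact h3 β hβ L (by rw [div_le_iff₀ hc] at hL; linarith [hL])

/-- **Exact dilation covariance of the floors**: `LowerBounds G r (c · a) ↔ LowerBounds G r a` for every `c > 0`. [folklore] -/
theorem lowerBounds_const_mul_iff (r : LatticeRep G) (a : ℝ → ℝ) {c : ℝ} (hc : 0 < c) :
    LowerBounds G r (fun β => c * a β) ↔ LowerBounds G r a := by
  refine ⟨lowerBounds_of_const_mul r hc, fun h => ?_⟩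
  have ha : a = fun β => c⁻¹ * (c * a β) := funext fun β => by field_simp
  rw [ha] at h
  exact lowerBounds_of_const_mul r (inv_pos.2 hc) h

/-! ### The ceilings and the gap leg -/

/-- **Ceilings at unit `c · a` give ceilings at unit `a`** (`c > 0`): divide the collar range `ℓ₄` by `c`. [folklore] -/
theorem momentBounds6_of_const_mul (r : LatticeRep G) {a : ℝ → ℝ} {c : ℝ} (hc : 0 < c)
    (h : MomentBounds6 G r (fun β => c * a β)) : MomentBounds6 G r a := by
  obtain ⟨C, β₄, ℓ₄, hℓ₄, hC, H⟩ := h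
  refine ⟨C, β₄, ℓ₄ / c, div_pos hℓ₄ hc, hC, fun β hβ L n q x R hq hR hRa hRL hsep => ?_⟩
  refine H β hβ L n q x R hq hR ?_ hRL hsep
  rw [le_div_iff₀ hc] at hRa
  calc (R : ℝ) * (c * a β) = (R : ℝ) * a β * c := by ring
    _ ≤ ℓ₄ := hRa

/-- **Exact dilation covariance of the plane-resolved ceilings.** [folklore] -/
theorem momentBounds6_const_mul_iff (r : LatticeRep G) (a : ℝ → ℝ) {c : ℝ} (hc : 0 < c) :
    MomentBounds6 G r (fun β => c * a β) ↔ MomentBounds6 G r a := by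
  refine ⟨momentBounds6_of_const_mul r hc, fun h => ?_⟩
  have ha : a = fun β => c⁻¹ * (c * a β) := funext fun β => by field_simp
  rw [ha] at h
  exact momentBounds6_of_const_mul r (inv_pos.2 hc) h

/-- **Ceilings (density form) at unit `c · a` give ceilings at unit `a`** (`c > 0`). [folklore] -/
theorem momentBounds_of_const_mul (r : LatticeRep G) {a : ℝ → ℝ} {c : ℝ} (hc : 0 < c)
    (h : MomentBounds G r (fun β => c * a β)) : MomentBounds G r a := by
  obtain ⟨C, β₄, ℓ₄, hℓ₄, hC, H⟩ := h
  refine ⟨C, β₄, ℓ₄ / c, div_pos hℓ₄ hc, hC, fun β hβ L n x R hR hRa hRL hsep => ?_⟩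
  refine H β hβ L n x R hR ?_ hRL hsep
  rw [le_div_iff₀ hc] at hRa
  calc (R : ℝ) * (c * a β) = (R : ℝ) * a β * c := by ring
    _ ≤ ℓ₄ := hRa

/-- **Exact dilation covariance of the density ceilings.** [folklore] -/
theorem momentBounds_const_mul_iff (r : LatticeRep G) (a : ℝ → ℝ) {c : ℝ} (hc : 0 < c) :
    MomentBounds G r (fun β => c * a β) ↔ MomentBounds G r a := by
  refine ⟨momentBounds_of_const_mul r hc, fun h => ?_⟩
  have ha : a = fun β => c⁻¹ * (c * a β) := funext fun β => by field_simp
  rw [ha] at h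
  exact momentBounds_of_const_mul r (inv_pos.2 hc) h

/-- **Gap in units `c · a` gives the gap in units `a`** (`c > 0`): multiply the rate constant by `c`. [folklore] -/
theorem gapInUnits_of_const_mul (r : LatticeRep G) {a : ℝ → ℝ} {c : ℝ} (hc : 0 < c)
    (h : GapInUnits G r (fun β => c * a β)) : GapInUnits G r a := by
  obtain ⟨c₁, β₂, S₁, hc₁, H⟩ := h
  refine ⟨c₁ * c, β₂, S₁, mul_pos hc₁ hc, fun A B => ?_⟩
  obtain ⟨C, hC⟩ := H A B
  refine ⟨C, fun β hβ S n hS hn => ?_⟩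
  have := hC β hβ S n hS hn
  calc |latticeConnectedCorr r.ρ β (2 * S + 1) A.F B.F n| ≤ C * Real.exp (-(c₁ * (c * a β) * n)) := this
    _ = C * Real.exp (-(c₁ * c * a β * n)) := by ring_nf

/-- **Exact dilation covariance of the gap leg.** [folklore] -/
theorem gapInUnits_const_mul_iff (r : LatticeRep G) (a : ℝ → ℝ) {c : ℝ} (hc : 0 < c) :
    GapInUnits G r (fun β => c * a β) ↔ GapInUnits G r a := by
  refine ⟨gapInUnits_of_const_mul r hc, fun h => ?_⟩
  have ha : a = fun β => c⁻¹ * (c * a β) := funext fun β => by field_simp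
  rw [ha] at h
  exact gapInUnits_of_const_mul r (inv_pos.2 hc) h

/-! ### The seam body and the route decl -/

/-- **The seam body is dilation covariant**: one representation carrying floors ∧ ceilings at unit `c · u` iff
one carrying them at unit `u`. [folklore] -/
theorem seamBody_const_mul_iff (u : ℝ → ℝ) {c : ℝ} (hc : 0 < c) :
    (∃ r : LatticeRep G, LowerBounds G r (fun β => c * u β) ∧ MomentBounds6 G r (fun β => c * u β)) ↔
      ∃ r : LatticeRep G, LowerBounds G r u ∧ MomentBounds6 G r u := by
  simp only [lowerBounds_const_mul_iff _ u hc, momentBounds6_const_mul_iff _ u hc]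

/-- **`UVSeamRec` does not see a constant rescaling of the unit of record**: for every `c > 0` the route decl
(floors ∧ ceilings at `uRec = exp (sizeLog · 1)`) is equivalent to the same statement at `c · uRec`.  The
kill-criterion repair «restate `u ↦ u/M`» therefore changes nothing; only the asymptotic class of `uRec` matters. [folklore] -/
theorem uvSeamRec_iff_const_mul (c : ℝ) (hc : 0 < c) :
    Summit.QuantumFields.YangMills.Theses.BalabanLadder.UVSeamRec ↔
      (Summit.QuantumFields.YangMills.Theses.BalabanLadder.UV →
        ∀ (G : Type) [Group G] [TopologicalSpace G] [IsTopologicalGroup G] [CompactSpace G],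
          IsCompactSimpleLieGroup G → Nonempty (G ≃ₜ* Matrix.specialUnitaryGroup (Fin 2) ℂ) →
          letI : MeasurableSpace G := borel G; haveI : BorelSpace G := ⟨rfl⟩;
          ∃ r : LatticeRep G, LowerBounds G r (fun β => c * Transport.uRec β) ∧
            MomentBounds6 G r (fun β => c * Transport.uRec β)) := by
  unfold Summit.QuantumFields.YangMills.Theses.BalabanLadder.UVSeamRec
  refine forall_congr' fun _ => forall_congr' fun G => forall_congr' fun _ => forall_congr' fun _ =>
    forall_congr' fun _ => forall_congr' fun _ => forall_congr' fun _ => forall_congr' fun _ => ?_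
  letI : MeasurableSpace G := borel G
  haveI : BorelSpace G := ⟨rfl⟩
  exact (seamBody_const_mul_iff (G := G) Transport.uRec hc).symm

/-- **The floors stub is dilation covariant**: floors for some lattice representation of `SU(2)` at `c · uRec` iff
at `uRec` (`c > 0`). [folklore] -/
theorem stubFloors_iff_const_mul (c : ℝ) (hc : 0 < c) :
    (letI : MeasurableSpace (Matrix.specialUnitaryGroup (Fin 2) ℂ) := borel _
     haveI : BorelSpace (Matrix.specialUnitaryGroup (Fin 2) ℂ) := ⟨rfl⟩
     ∃ r : LatticeRep (Matrix.specialUnitaryGroup (Fin 2) ℂ),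
       LowerBounds (Matrix.specialUnitaryGroup (Fin 2) ℂ) r (fun β => c * Transport.uRec β)) ↔
    (letI : MeasurableSpace (Matrix.specialUnitaryGroup (Fin 2) ℂ) := borel _
     haveI : BorelSpace (Matrix.specialUnitaryGroup (Fin 2) ℂ) := ⟨rfl⟩
     ∃ r : LatticeRep (Matrix.specialUnitaryGroup (Fin 2) ℂ),
       LowerBounds (Matrix.specialUnitaryGroup (Fin 2) ℂ) r Transport.uRec) := by
  letI : MeasurableSpace (Matrix.specialUnitaryGroup (Fin 2) ℂ) := borel _
  haveI : BorelSpace (Matrix.specialUnitaryGroup (Fin 2) ℂ) := ⟨rfl⟩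
  exact exists_congr fun r => lowerBounds_const_mul_iff r Transport.uRec hc

/-- **The ceilings stub is dilation covariant**: plane-resolved ceilings for every lattice representation of `SU(2)`
at `c · uRec` iff at `uRec` (`c > 0`). [folklore] -/
theorem stubCeilings_iff_const_mul (c : ℝ) (hc : 0 < c) :
    (letI : MeasurableSpace (Matrix.specialUnitaryGroup (Fin 2) ℂ) := borel _
     haveI : BorelSpace (Matrix.specialUnitaryGroup (Fin 2) ℂ) := ⟨rfl⟩
     ∀ r : LatticeRep (Matrix.specialUnitaryGroup (Fin 2) ℂ),
       MomentBounds6 (Matrix.specialUnitaryGroup (Fin 2) ℂ) r (fun β => c * Transport.uRec β)) ↔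
    (letI : MeasurableSpace (Matrix.specialUnitaryGroup (Fin 2) ℂ) := borel _
     haveI : BorelSpace (Matrix.specialUnitaryGroup (Fin 2) ℂ) := ⟨rfl⟩
     ∀ r : LatticeRep (Matrix.specialUnitaryGroup (Fin 2) ℂ),
       MomentBounds6 (Matrix.specialUnitaryGroup (Fin 2) ℂ) r Transport.uRec) := by
  letI : MeasurableSpace (Matrix.specialUnitaryGroup (Fin 2) ℂ) := borel _
  haveI : BorelSpace (Matrix.specialUnitaryGroup (Fin 2) ℂ) := ⟨rfl⟩
  exact forall_congr' fun r => momentBounds6_const_mul_iff r Transport.uRec hc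

end Summit.QuantumFields.YangMills.Cruxes.UVSeamRec.UnitDilation

end
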